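import Summits.BirchSwinnertonDyer.BirchSwinnertonDyer.Theorems.ByReductionTypeAtTwoRankOneNaiveSigmaLogRecursion
import Literature.NumberTheory.EllipticCurves.PadicLogOfEvalProofs
import HarnessLib

/-!
# Route `ByReductionTypeAtTwo`, crux `RankOneAtTwoBigImageOddLocal` (item stmt-BirchSwinnertonDyer-23715), line AN62, σ₀-LEMMA BLOCK
# (cell `bsd-f1-sign2`, planner seat `-an` g49; `--supports 23715`, helper; sequel of `…NaiveSigmaLogRecursion`): **`Σ₀` converges
# on level `≥ 2` and `log₂ Σ₀(t) = 2·log₂ t + L(t)` there** — the analytic evaluation step of the naive `2`-adic σ-height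

HONEST FRAMING (D-0036/D-0054): THEOREMS ONLY (no definition, no named fact, no `sorry`, no instance); `2`-adic analysis of the
formal sigma function of a Weierstrass model over `ℚ₂` (`a₁ = 0`, `a₂, a₃, a₄, a₆ ∈ ℤ₂`), NOT a statement about `BSDp`; item 23715
stays OPEN; BSD is proved for no curve.  Gate-backed forms of the workfile theorems 53D / 53H of
`Cruxes/RankOneAtTwoBigImageOddLocal/WildPairHeightAN62.lean` §8 (-an g49).

* §1 generic power-series lemmas over `ℚ₂`: `eq_exp_subst_of_mul_derivative` (`F·L′ = F′`, `F(0) = 1`, `L(0) = 0` ⟹ `F = exp(L)`),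
  `norm_coeff_sigmaLog_mul_four_le` (`‖[t^k]L‖ ≤ 2^k/4` from 50A), `norm_coeff_pow_le_of_mul_four_le`, `norm_coeff_exp_subst_le`
  (`‖[tⁿ]exp(L)‖ ≤ 2ⁿ`, using `v₂(m!) ≤ m`), `derivative_rescale_eq`, `padicEval_rescale`, `hasSum_coeff_X_mul`.
* §2 **`norm_coeff_sigmaShift_sigmaShift_le`** (53D) — `‖[tⁿ](Σ₀/t²)‖ ≤ 2ⁿ`: `Σ₀` converges for `‖t‖ < ½` (Bernardi's `v₂ t > 1`).
* §3 **`padicLog_padicEval_sigmaSq_two`** (53H) — `log₂ Σ₀(t) = 2log₂ t + L(t)` for `0 < ‖t‖ ≤ ¼` (rescaling by `2` + the tree's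
  `padicLog_padicEval`).

References: [cite: Bernardi1981, §1] [cite: MazurSteinTate2006, §2.7, Thm. 1.3] [cite: SilvermanAEC2009, IV.1.1].
-/

set_option autoImplicit false

noncomputable section

open scoped Classical

open PowerSeries WeierstrassCurve Literature.NumberTheory.EllipticCurves

namespace Summit.BirchSwinnertonDyer.BirchSwinnertonDyer.Theorems

namespace NaiveSigmaLogAtTwo

/-! ### §1 Power-series lemmas over `ℚ₂` -/

/-- Uniqueness for `F·L′ = F′`, `F(0) = 1`, `L(0) = 0`: `F = exp(L)`. -/
theorem eq_exp_subst_of_mul_derivative {F L : ℚ_[2]⟦X⟧} (hL0 : constantCoeff L = 0) (hF0 : constantCoeff F = 1)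
    (hF : F * d⁄dX ℚ_[2] L = d⁄dX ℚ_[2] F) : F = (exp ℚ_[2]).subst L := by
  set E : ℚ_[2]⟦X⟧ := (exp ℚ_[2]).subst L with hEdef
  have hsub : HasSubst L := HasSubst.of_constantCoeff_zero' hL0
  have hE0 : constantCoeff E = 1 := by
    rw [hEdef, constantCoeff_subst_of_constantCoeff _ hL0, constantCoeff_exp]
  have hE : E * d⁄dX ℚ_[2] L = d⁄dX ℚ_[2] E := by
    rw [hEdef, derivative_subst ℚ_[2] hsub, derivative_exp]
  have hD0 : constantCoeff (F - E) = 0 := by rw [map_sub, hF0, hE0, sub_self]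
  have hD : (F - E) * d⁄dX ℚ_[2] L = d⁄dX ℚ_[2] (F - E) := by rw [sub_mul, hF, hE, map_sub]
  have hcoeff : ∀ n : ℕ, ∀ i ≤ n, coeff i (F - E) = 0 := by
    intro n
    induction n with
    | zero =>
      intro i hi
      rw [Nat.le_zero.mp hi, coeff_zero_eq_constantCoeff]; exact hD0
    | succ n ih =>
      intro i hi
      rcases Nat.lt_or_ge i (n + 1) with h | h
      · exact ih i (by omega)
      · obtain rfl : i = n + 1 := le_antisymm hi h
        have e := congrArg (coeff n) hD
        rw [coeff_derivative, PowerSeries.coeff_mul, Finset.sum_eq_zero] at e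
        · have hn : ((n : ℚ_[2]) + 1) ≠ 0 := by exact_mod_cast Nat.succ_ne_zero n
          exact (mul_eq_zero.mp e.symm).resolve_right hn
        · intro ij hij
          have := Finset.HasAntidiagonal.mem_antidiagonal.mp hij
          rw [ih ij.1 (by omega), zero_mul]
  rw [← sub_eq_zero]
  ext n
  rw [map_zero]
  exact hcoeff n n le_rfl

/-- `‖[t^k]L‖ ≤ 2^k/4` for every `k`, under the hypotheses of 50A (`l₀ = l₁ = 0`, `‖a₂‖, ‖a₃‖ ≤ 1`, `‖l₄‖ ≤ 2`, `‖l_k‖ ≤ 2^{k−4}`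
for `k ≥ 5`). -/
theorem norm_coeff_sigmaLog_mul_four_le (W : WeierstrassCurve ℚ_[2]) (Sq L : ℚ_[2]⟦X⟧) (ha1 : W.a₁ = 0)
    (ha2 : ‖W.a₂‖ ≤ 1) (ha3 : ‖W.a₃‖ ≤ 1) (ha4 : ‖W.a₄‖ ≤ 1) (ha6 : ‖W.a₆‖ ≤ 1)
    (h2 : coeff 2 Sq = 1) (h3 : coeff 3 Sq = 0) (hODE : W.SatisfiesSigmaSqODE Sq 0) (hL0 : constantCoeff L = 0)
    (hL : sigmaShift (sigmaShift Sq) * d⁄dX ℚ_[2] L = d⁄dX ℚ_[2] (sigmaShift (sigmaShift Sq))) :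
    ∀ k : ℕ, ‖coeff k L‖ * 4 ≤ 2 ^ k := by
  obtain ⟨hl1, hl2, hl3, hl4, hbound⟩ := naiveSigmaLog_denominators_two W Sq L ha1 ha2 ha3 ha4 ha6 h2 h3 hODE hL
  have hl0 : coeff 0 L = 0 := by rw [coeff_zero_eq_constantCoeff]; exact hL0
  have h2 : ‖(2 : ℚ_[2])‖ = 2⁻¹ := by exact_mod_cast (Padic.norm_p (p := 2))
  have h3 : ‖(3 : ℚ_[2])‖ = 1 := by
    rw [show (3 : ℚ_[2]) = ((3 : ℕ) : ℚ_[2]) by norm_num, Padic.norm_natCast_eq_one_iff]; decide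
  have h5 : ‖(5 : ℚ_[2])‖ = 1 := by
    rw [show (5 : ℚ_[2]) = ((5 : ℕ) : ℚ_[2]) by norm_num, Padic.norm_natCast_eq_one_iff]; decide
  have h6 : ‖(6 : ℚ_[2])‖ = 2⁻¹ := by
    rw [show (6 : ℚ_[2]) = 2 * 3 by norm_num, norm_mul, h2, h3, mul_one]
  have hl4n : ‖coeff 4 L‖ ≤ 2 := by
    rw [hl4]
    refine (IsUltrametricDist.norm_add_le_max _ _).trans (max_le ?_ ?_)
    · rw [norm_div, h2, norm_pow]
      calc ‖W.a₂‖ ^ 2 / 2⁻¹ = ‖W.a₂‖ ^ 2 * 2 := by ring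
        _ ≤ 1 ^ 2 * 2 := by gcongr
        _ = 2 := by ring
    · rw [norm_div, norm_mul, h5, h6, one_mul]
      calc ‖W.a₄‖ / 2⁻¹ = ‖W.a₄‖ * 2 := by ring
        _ ≤ 1 * 2 := by gcongr
        _ = 2 := by ring
  have hlk : ∀ k : ℕ, 5 ≤ k → ‖coeff k L‖ ≤ (2 : ℝ) ^ (k - 4) := by
    intro k hk
    have hb := hbound k (by omega)
    have he := padicValNat_add_log_add_three_le hk
    have hpow : (2 : ℝ) ^ (padicValNat 2 k + Nat.log 2 (k - 1)) ≤ 2 ^ (k - 4) * 2 := by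
      rw [← pow_succ]
      exact pow_le_pow_right₀ (by norm_num) (by omega)
    nlinarith [hb, hpow, norm_nonneg (coeff k L)]
  intro k
  rcases Nat.lt_or_ge k 5 with hk | hk
  · interval_cases k
    · rw [hl0, norm_zero, zero_mul]; norm_num
    · rw [hl1, norm_zero, zero_mul]; norm_num
    · rw [hl2]; linarith
    · rw [hl3]; linarith
    · linarith
  · have hl := hlk k hk
    obtain ⟨j, rfl⟩ : ∃ j, k = j + 5 := ⟨k - 5, by omega⟩
    rw [show j + 5 - 4 = j + 1 from by omega] at hl
    calc ‖coeff (j + 5) L‖ * 4 ≤ 2 ^ (j + 1) * 4 := by gcongr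
      _ = 2 ^ (j + 3) := by ring
      _ ≤ 2 ^ (j + 5) := pow_le_pow_right₀ (by norm_num) (by omega)

/-- `‖[tⁿ]L^m‖ ≤ 2ⁿ/4^m` when `‖[t^k]L‖ ≤ 2^k/4` (ultrametric convolution). -/
theorem norm_coeff_pow_le_of_mul_four_le {L : ℚ_[2]⟦X⟧} (hLb : ∀ k : ℕ, ‖coeff k L‖ * 4 ≤ 2 ^ k) :
    ∀ m n : ℕ, ‖coeff n (L ^ m)‖ ≤ 2 ^ n / 4 ^ m := by
  intro m
  induction m with
  | zero =>
    intro n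
    rw [pow_zero, pow_zero, div_one, coeff_one]
    split_ifs with h
    · rw [norm_one]; exact one_le_pow₀ (by norm_num)
    · rw [norm_zero]; positivity
  | succ m ih =>
    intro n
    rw [pow_succ, PowerSeries.coeff_mul]
    refine IsUltrametricDist.norm_sum_le_of_forall_le_of_nonneg (by positivity) fun ij hij => ?_
    have hn : ij.1 + ij.2 = n := Finset.HasAntidiagonal.mem_antidiagonal.mp hij
    have hj : ‖coeff ij.2 L‖ ≤ 2 ^ ij.2 / 4 := by
      rw [le_div_iff₀ (by norm_num : (0 : ℝ) < 4)]; exact hLb ij.2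
    rw [norm_mul]
    calc ‖coeff ij.1 (L ^ m)‖ * ‖coeff ij.2 L‖ ≤ (2 ^ ij.1 / 4 ^ m) * (2 ^ ij.2 / 4) :=
          mul_le_mul (ih ij.1) hj (norm_nonneg _) (by positivity)
      _ = 2 ^ n / 4 ^ (m + 1) := by rw [← hn, pow_add, pow_succ]; ring

/-- `‖[tⁿ] exp(L)‖ ≤ 2ⁿ` when `L(0) = 0` and `‖[t^k]L‖ ≤ 2^k/4` (with `‖1/m!‖₂ = 2^{v₂(m!)} ≤ 2^m`). -/
theorem norm_coeff_exp_subst_le {L : ℚ_[2]⟦X⟧} (hL0 : constantCoeff L = 0)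
    (hLb : ∀ k : ℕ, ‖coeff k L‖ * 4 ≤ 2 ^ k) (n : ℕ) : ‖coeff n ((exp ℚ_[2]).subst L)‖ ≤ 2 ^ n := by
  rw [coeff_subst_eq_sum_range_of_constantCoeff _ hL0]
  refine IsUltrametricDist.norm_sum_le_of_forall_le_of_nonneg (by positivity) fun m _ => ?_
  rw [norm_mul, coeff_exp]
  have hf0 : ((m.factorial : ℕ) : ℚ_[2]) ≠ 0 := by exact_mod_cast m.factorial_ne_zero
  have hfact : ‖algebraMap ℚ ℚ_[2] (1 / (m.factorial : ℚ))‖ ≤ 2 ^ m := by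
    rw [map_div₀, map_one, map_natCast, one_div, norm_inv, Padic.norm_eq_zpow_neg_valuation hf0,
      Padic.valuation_natCast, zpow_neg, inv_inv, zpow_natCast]
    exact_mod_cast pow_le_pow_right₀ (by norm_num : (1 : ℝ) ≤ 2) (padicValNat_factorial_le 2 m)
  calc ‖algebraMap ℚ ℚ_[2] (1 / (m.factorial : ℚ))‖ * ‖coeff n (L ^ m)‖ ≤ 2 ^ m * (2 ^ n / 4 ^ m) :=
        mul_le_mul hfact (norm_coeff_pow_le_of_mul_four_le hLb m n) (norm_nonneg _) (by positivity)
    _ = 2 ^ n * (2 ^ m / 4 ^ m) := by ring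
    _ ≤ 2 ^ n * 1 := by
        gcongr
        rw [div_le_one (by positivity)]
        exact pow_le_pow_left₀ (by norm_num) (by norm_num) m
    _ = 2 ^ n := mul_one _

/-- `d/dX f(aX) = a·f′(aX)`. -/
theorem derivative_rescale_eq (a : ℚ_[2]) (f : ℚ_[2]⟦X⟧) :
    d⁄dX ℚ_[2] (rescale a f) = C a * rescale a (d⁄dX ℚ_[2] f) := by
  ext n
  rw [coeff_derivative, coeff_rescale, coeff_C_mul, coeff_rescale, coeff_derivative, pow_succ]
  ring

/-- `f(aX)` evaluated at `u` is `f` evaluated at `a·u` (termwise). -/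
theorem padicEval_rescale (a : ℚ_[2]) (f : ℚ_[2]⟦X⟧) (u : ℚ_[2]) :
    padicEval (rescale a f) u = padicEval f (a * u) := by
  unfold padicEval
  refine tsum_congr fun n => ?_
  rw [coeff_rescale, mul_pow]; ring

/-- Shifting a convergent evaluation: `(X·f)(t) = t·f(t)`. -/
theorem hasSum_coeff_X_mul {f : ℚ_[2]⟦X⟧} {t a : ℚ_[2]} (hf : HasSum (fun n : ℕ => coeff n f * t ^ n) a) :
    HasSum (fun n : ℕ => coeff n (X * f) * t ^ n) (t * a) := by
  refine (hasSum_nat_add_iff' 1).mp ?_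
  rw [Finset.sum_range_one, coeff_zero_X_mul, zero_mul, sub_zero]
  have : (fun n : ℕ => coeff (n + 1) (X * f) * t ^ (n + 1)) = fun n : ℕ => t * (coeff n f * t ^ n) := by
    funext n; rw [coeff_succ_X_mul, pow_succ]; ring
  rw [this]
  exact hf.mul_left t

/-! ### §2–§3 53D and 53H -/

/-- **53D — `Σ₀` CONVERGES ON ALL OF LEVEL `≥ 2`** (kernel): `‖[tⁿ](Σ₀/t²)‖ ≤ 2ⁿ` over `ℚ₂` with `a₁ = 0`, `a₂, a₃, a₄, a₆ ∈ ℤ₂`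
(`Σ₀/t² = exp(L)`, `‖[tⁿ]L^m‖ ≤ 2ⁿ/4^m`, `‖1/m!‖₂ ≤ 2^m`).  [cite: Bernardi1981, §1 (σ converges for v_p(t) > 1/(p−1))] -/
theorem norm_coeff_sigmaShift_sigmaShift_le (W : WeierstrassCurve ℚ_[2]) (Sq L : ℚ_[2]⟦X⟧) (ha1 : W.a₁ = 0)
    (ha2 : ‖W.a₂‖ ≤ 1) (ha3 : ‖W.a₃‖ ≤ 1) (ha4 : ‖W.a₄‖ ≤ 1) (ha6 : ‖W.a₆‖ ≤ 1)
    (h2 : coeff 2 Sq = 1) (h3 : coeff 3 Sq = 0) (hODE : W.SatisfiesSigmaSqODE Sq 0) (hL0 : constantCoeff L = 0)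
    (hL : sigmaShift (sigmaShift Sq) * d⁄dX ℚ_[2] L = d⁄dX ℚ_[2] (sigmaShift (sigmaShift Sq))) (n : ℕ) :
    ‖coeff n (sigmaShift (sigmaShift Sq))‖ ≤ 2 ^ n := by
  have hS0 : constantCoeff (sigmaShift (sigmaShift Sq)) = 1 := by rw [constantCoeff_sigmaShift, coeff_sigmaShift, h2]
  have hLb := norm_coeff_sigmaLog_mul_four_le W Sq L ha1 ha2 ha3 ha4 ha6 h2 h3 hODE hL0 hL
  rw [eq_exp_subst_of_mul_derivative hL0 hS0 hL]
  exact norm_coeff_exp_subst_le hL0 hLb n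

/-- **53H — `log₂ Σ₀(t) = 2·log₂ t + L(t)` AT LEVEL `≥ 2`** (kernel): over `ℚ₂` with `a₁ = 0`, `a₂, a₃, a₄, a₆ ∈ ℤ₂`, for
`Σ₀ = t² + O(t⁴)` the constant-`0` solution of the sigma-squared equation and `L = log(Σ₀/t²)` (`L(0) = 0`, `S·L′ = S′`), and every
`t` with `0 < ‖t‖ ≤ ¼`: `padicLog 2 (Σ₀(t)) = 2·padicLog 2 t + L(t)` (`padicEval` sums).  Proof: `S₀ := Σ₀/t² = exp(L)`; 53D makes
`S₀(2X), L(2X)` `2`-integral, so the tree's `padicLog_padicEval` at `u = t/2` gives `log₂ S₀(t) = L(t)`; `Σ₀(t) = t²S₀(t)` (two shifts of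
a summable series); `padicLog_mul`.  At level 1 (`‖t‖ = ½`) `Σ₀(t)` diverges — hence `‖t‖ ≤ ¼`.
[cite: Bernardi1981, §1] [cite: MazurSteinTate2006, §2.7, Thm. 1.3] -/
theorem padicLog_padicEval_sigmaSq_two (W : WeierstrassCurve ℚ_[2]) (Sq L : ℚ_[2]⟦X⟧) (ha1 : W.a₁ = 0)
    (ha2 : ‖W.a₂‖ ≤ 1) (ha3 : ‖W.a₃‖ ≤ 1) (ha4 : ‖W.a₄‖ ≤ 1) (ha6 : ‖W.a₆‖ ≤ 1)
    (h0 : constantCoeff Sq = 0) (h1 : coeff 1 Sq = 0) (h2 : coeff 2 Sq = 1) (h3 : coeff 3 Sq = 0)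
    (hODE : W.SatisfiesSigmaSqODE Sq 0) (hL0 : constantCoeff L = 0)
    (hL : sigmaShift (sigmaShift Sq) * d⁄dX ℚ_[2] L = d⁄dX ℚ_[2] (sigmaShift (sigmaShift Sq)))
    (t : ℚ_[2]) (ht0 : t ≠ 0) (ht : ‖t‖ ≤ (2⁻¹ : ℝ) ^ 2) :
    padicLog 2 (padicEval Sq t) = 2 * padicLog 2 t + padicEval L t := by
  have hSb := norm_coeff_sigmaShift_sigmaShift_le W Sq L ha1 ha2 ha3 ha4 ha6 h2 h3 hODE hL0 hL
  have hLb := norm_coeff_sigmaLog_mul_four_le W Sq L ha1 ha2 ha3 ha4 ha6 h2 h3 hODE hL0 hL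
  set S : ℚ_[2]⟦X⟧ := sigmaShift (sigmaShift Sq) with hSdef
  have hS0 : constantCoeff S = 1 := by rw [hSdef, constantCoeff_sigmaShift, coeff_sigmaShift, h2]
  -- norms
  have h2n : ‖(2 : ℚ_[2])‖ = 2⁻¹ := by exact_mod_cast (Padic.norm_p (p := 2))
  have htn0 : 0 ≤ ‖t‖ := norm_nonneg t
  have hu : ‖t / 2‖ < 1 := by
    rw [norm_div, h2n]
    calc ‖t‖ / 2⁻¹ = ‖t‖ * 2 := by ring
      _ ≤ (2⁻¹ : ℝ) ^ 2 * 2 := by gcongr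
      _ < 1 := by norm_num
  have h2t : (2 : ℚ_[2]) * (t / 2) = t := by field_simp
  -- the rescaled, integral series
  set F : ℚ_[2]⟦X⟧ := rescale (2 : ℚ_[2]) S with hFdef
  set G : ℚ_[2]⟦X⟧ := rescale (2 : ℚ_[2]) L with hGdef
  have hF : IsPadicInt F := by
    rw [isPadicInt_iff_coeff]; intro n
    rw [hFdef, coeff_rescale, norm_mul, norm_pow, h2n]
    calc (2⁻¹ : ℝ) ^ n * ‖coeff n S‖ ≤ (2⁻¹ : ℝ) ^ n * 2 ^ n := by gcongr; exact hSb n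
      _ = 1 := by rw [← mul_pow, inv_mul_cancel₀ two_ne_zero, one_pow]
  have hG : IsPadicInt G := by
    rw [isPadicInt_iff_coeff]; intro n
    rw [hGdef, coeff_rescale, norm_mul, norm_pow, h2n]
    have hn : ‖coeff n L‖ ≤ 2 ^ n / 4 := by
      rw [le_div_iff₀ (by norm_num : (0 : ℝ) < 4)]; exact hLb n
    calc (2⁻¹ : ℝ) ^ n * ‖coeff n L‖ ≤ (2⁻¹ : ℝ) ^ n * (2 ^ n / 4) := by gcongr
      _ = ((2⁻¹ : ℝ) * 2) ^ n / 4 := by rw [mul_pow]; ring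
      _ ≤ 1 := by rw [inv_mul_cancel₀ two_ne_zero, one_pow]; norm_num
  have hF0 : constantCoeff F = 1 := by
    rw [← coeff_zero_eq_constantCoeff_apply, hFdef, coeff_rescale, pow_zero, one_mul, coeff_zero_eq_constantCoeff_apply, hS0]
  have hG0 : constantCoeff G = 0 := by
    rw [← coeff_zero_eq_constantCoeff_apply, hGdef, coeff_rescale, pow_zero, one_mul, coeff_zero_eq_constantCoeff_apply, hL0]
  have hGF : d⁄dX ℚ_[2] G * F = d⁄dX ℚ_[2] F := by
    rw [hGdef, hFdef, derivative_rescale_eq, derivative_rescale_eq, mul_assoc, ← map_mul, mul_comm (d⁄dX ℚ_[2] L) S, hL]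
  have key := padicLog_padicEval hF hF0 hG0 hGF hu
  rw [hFdef, hGdef, padicEval_rescale, padicEval_rescale, h2t] at key
  -- `Σ₀(t) = t²·S₀(t)`
  have hgeo : Summable (fun n : ℕ => (2⁻¹ : ℝ) ^ n) := summable_geometric_of_lt_one (by norm_num) (by norm_num)
  have hsumS : Summable (fun n : ℕ => coeff n S * t ^ n) := by
    refine Summable.of_norm_bounded hgeo fun n => ?_
    rw [norm_mul, norm_pow]
    calc ‖coeff n S‖ * ‖t‖ ^ n ≤ 2 ^ n * ((2⁻¹ : ℝ) ^ 2) ^ n := by gcongr; exact hSb n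
      _ = (2 * (2⁻¹ : ℝ) ^ 2) ^ n := by rw [mul_pow]
      _ ≤ (2⁻¹ : ℝ) ^ n := by norm_num
  have hev1 : HasSum (fun n : ℕ => coeff n (sigmaShift Sq) * t ^ n) (t * padicEval S t) := by
    have e : X * S = sigmaShift Sq := by rw [hSdef]; exact X_mul_sigmaShift (by rw [constantCoeff_sigmaShift, h1])
    have := hasSum_coeff_X_mul hsumS.hasSum
    rwa [e] at this
  have hev2 : HasSum (fun n : ℕ => coeff n Sq * t ^ n) (t * (t * padicEval S t)) := by
    have e : X * sigmaShift Sq = Sq := X_mul_sigmaShift h0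
    have := hasSum_coeff_X_mul hev1
    rwa [e] at this
  have hevSq : padicEval Sq t = t * (t * padicEval S t) := by unfold padicEval; exact hev2.tsum_eq
  -- `S₀(t) ≠ 0`
  have hSne : padicEval S t ≠ 0 := by
    have hval : padicEval S t = padicEval F (t / 2) := by rw [hFdef, padicEval_rescale, h2t]
    have hlt : ‖padicEval (F - 1) (t / 2)‖ < 1 :=
      norm_padicEval_lt_one (hF.sub IsPadicInt.one) (by rw [map_sub, hF0, map_one, sub_self]) hu
    rw [padicEval_sub hF IsPadicInt.one hu, padicEval_one] at hlt
    intro hzero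
    rw [← hval, hzero, zero_sub, norm_neg, norm_one] at hlt
    exact lt_irrefl _ hlt
  rw [hevSq, padicLog_mul_holds 2 ht0 (mul_ne_zero ht0 hSne), padicLog_mul_holds 2 ht0 hSne, key]
  ring

end NaiveSigmaLogAtTwo

end Summit.BirchSwinnertonDyer.BirchSwinnertonDyer.Theorems
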